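/-
Copyright (c) 2026 the pub-hodgecm-mathlib formalisation cell (harness21).  Prover seat hodgecm-mathlib-K2E3-p03 (g0), HCML Track B «K2-LIT», row #3 of SIGS-TABLE-K2E3;
DEALS BATCH #1 (ii) (K2E3-plan (g1) 2026-09-03T22:03Z): `‹#3H› → ‹#3›`.
-/
import Summits.HodgeConjecture.HodgeConjecture.Theorems.K2E3GermResidueAtCubicTorusOfHomogeneity   -- ★ p855036∕p855099 (this seat): the reduction (core + heads); brings ★ (G3)-NOT-WILD and ★ row #21 `K2E3EPFunctionGWild`
import HarnessLib

/-!
# K2 · E3 — `Theorems/K2E3GermResidueAtCubicTorusOfRay.lean`: SOCKET #3 `sig_K2E3GermResidueAtCubicTorus` FROM THE HOMOGENEITY-ON-A-RAY LETTER `‹#3H›` ALONE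
# (Rogawski 1990 §8.1 Prop. 8.1.1, Prop. 8.1.2 (b), (8.1.1)–(8.1.2) p. 116, §12.7 p. 194; Kottwitz 1988 §2 Thm. 2)

HCML Track B «K2-LIT», cell `pub/hodgecm-mathlib`, crux H413 = `stmt-HodgeConjecture-24833` (lane `--supports … --as helper`), seat `hodgecm-mathlib-K2E3-p03` (g0); DEALS
BATCH #1 (ii) of the E3 dealer K2E3-plan (g1): «`Theorems/K2E3GermResidueAtCubicTorusOfRay.lean : ‹#3H› → ‹#3›` … on ACCEPT U3 ED. 3 re-ties #3 DERIVED and #3H becomes U3's live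
socket».  ONE theorem, `germResidueAtCubicTorus_of_ray`, whose HYPOTHESIS is the text of the candidate socket U3-d `sig_K2E3ShalikaGermHomogeneityRay` (HOME
`K2/K2E3-p03/g0/sig_K2E3ShalikaGermHomogeneityRay.cand.K2E3-p03-g0.lean`) and whose CONCLUSION is the text of socket #3 `U3CubicGerms.sig_K2E3GermResidueAtCubicTorus`
(`Cruxes/H413/Lines/K2_E3_EllipticInputsSigs_U3CubicGerms.lean` 4659ff0f2fc0809e :89–:104) — both TOKEN FOR TOKEN with the Lines-side `abbrev Pl L := HeightOneSpectrum (𝓞 L⁺)`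
inlined (as every K2E3 Theorems file; the tie is `rfl`).

THE MATHEMATICS (all inputs ★).  Unpack socket #3's prefix; the germ expansion `hexp : ShalikaGermExpansionNonsplit L Φ₃ v` applied to the canonical family (admissible on the
regular classes by ★ `IsCanonical.isAdmissibleOn`) yields an expansion datum `(S, mU, Γ)` (`S` unipotent, `mU` admissible on `S`, the identity near `1`); `‹#3H›` yields the ray
`γ_n → 1` of regular elements of `T` with `Γ_u([γ_n]) = q^{n·a_u}·g_u` (`u ≠ [1]`, `n ≥ n₀`); at the (unique) place `w ∣ v` either `e(w|v) = 1 ∨ |2|_w = 1` and ★ (G3)-NOT-WILD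
`exists_epFunction_G_of_ramificationIdx'_or_valued_two` gives Kottwitz's Euler–Poincaré function, or `e(w|v) ≠ 1 ∧ |2|_w < 1` and ★ row #21 `K2E3EPFunctionGWild.epFunctionGWild`
does; the CORE ★ `germResidueAtTorus_of_epFunction_of_homogeneityRay` (trivial germ eliminated by the Euler–Poincaré identity, `c = 1∕f_G(1)`) concludes
★ `ShalikaGermResidueAtTorus L Φ₃ v mQv T`.  (Equivalently ★ `germResidueAtTorus_of_homogeneityRay_nonsplit`, ED. 2.)

HONEST LABEL: count-neutral until U3-d is a registered socket; then socket #3 is DERIVED by this file and the XL debt of row #3 is EXACTLY U3-d (homogeneity of the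
non-trivial Shalika germs on one ray, [Rogawski1990 Prop. 8.1.2 (b); HarishChandra1999 Thm. 8.1 (1)]).  HC_CM is proved only modulo the 7 printed citations (2 remaining named
inputs: hLiu418 = `stmt-HodgeConjecture-24832`, h413 = `stmt-HodgeConjecture-24833`) until rung 0 closes.  No `sorry`, axioms ⊆ the trio, no `def`, no instance, no notation.

## References
* [Rogawski1990] J. D. Rogawski, *Automorphic Representations of Unitary Groups in Three Variables*, Ann. of Math. Stud. 123 (1990): §8.1 Prop. 8.1.1 p. 112, Prop. 8.1.2 (b)
  p. 114, (8.1.1)–(8.1.2) p. 116; §12.6 p. 187; Lemma 12.7.2 (proof) pp. 194–195.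
* [HarishChandra1999AdmissibleDistributions] Harish-Chandra (DeBacker–Sally notes), *Admissible Invariant Distributions on Reductive p-adic Groups*, AMS ULS 16 (1999): Thm. 8.1.
* [Kottwitz1988] R. E. Kottwitz, *Tamagawa numbers*, Ann. of Math. 127 (1988), §2 Theorem 2.
-/

set_option autoImplicit false
-- the mandated namespace has the single-problem summit's repeated segment (`HodgeConjecture.HodgeConjecture`)
set_option linter.dupNamespace false

noncomputable section

open NumberField IsDedekindDomain MeasureTheory Filter Topology
open scoped Matrix MatrixGroups Valued NNReal
open Literature.NumberTheory.Rogawski1990 Literature.NumberTheory.Automorphic Literature.NumberTheory.Automorphic.UnitaryGroup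
open Literature.MeasureTheory.Group
open Summit.HodgeConjecture.HodgeConjecture.Cruxes.H413.F0P3cStCharTSEPGlueGNotWild
open Summit.HodgeConjecture.HodgeConjecture.Cruxes.H413.K2E3GermResidueAtCubicTorusOfHomogeneity

namespace Summit.HodgeConjecture.HodgeConjecture.Cruxes.H413.K2E3GermResidueAtCubicTorusOfRay

set_option maxHeartbeats 1600000 in  -- statement-level `whnf` on the CM carriers (the socket module's own budget line)
set_option synthInstance.maxHeartbeats 400000 in  -- idem
open scoped Classical in
/-- **SOCKET #3 FROM THE HOMOGENEITY-ON-A-RAY LETTER: `‹#3H› → ‹#3›`** — hypothesis = U3-d `sig_K2E3ShalikaGermHomogeneityRay` (for every non-split `v`, canonical `mQv`,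
compact `T = Z(γ₀)` of type (3) and EVERY expansion datum `(S, mU, Γ)`: a regular sequence `γ_n → 1` in `T`, `‖q‖ > 1`, `a_u ≥ 1`, `g_u`, `n₀` with `Γ_u([γ_n]) = q^{n·a_u}·g_u`
for `n ≥ n₀`, `u ∈ S ∖ {[1]}`), conclusion = socket #3 `sig_K2E3GermResidueAtCubicTorus` (the residue ★ `ShalikaGermResidueAtTorus L Φ₃ v mQv T`), both token for token with
`Pl L` inlined.  Proof: ★ expansion datum from `hexp` + the ray from the hypothesis + Kottwitz's Euler–Poincaré function at every non-split place (★ (G3)-NOT-WILD ∕ ★ row #21)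
into the CORE ★ `germResidueAtTorus_of_epFunction_of_homogeneityRay`.
[cite: Rogawski1990, §8.1 Prop. 8.1.1 p. 112; Prop. 8.1.2 (b) p. 114; (8.1.1)–(8.1.2) p. 116; §12.7 p. 194] [cite: Kottwitz1988, §2 Theorem 2]
[cite: HarishChandra1999AdmissibleDistributions, Thm. 8.1 p. 48] -/
theorem germResidueAtCubicTorus_of_ray
    (hHOM :
      ∀ (L : Type) [Field L] [NumberField L] [IsCMField L] (v : HeightOneSpectrum (𝓞 ↥(maximalRealSubfield L))),
        (∀ w : PlacesOver L v, IsCMField.complexConj L • w.1 = w.1) →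
        ∀ [MeasurableSpace (Gqs L v)] [BorelSpace (Gqs L v)]
          [∀ γ : Gqs L v, MeasurableSpace (Gqs L v ⧸ Subgroup.centralizer ({γ} : Set (Gqs L v)))]
          [∀ γ : Gqs L v, BorelSpace (Gqs L v ⧸ Subgroup.centralizer ({γ} : Set (Gqs L v)))]
          (νQv : Measure (Gqs L v)) [νQv.IsHaarMeasure] [νQv.IsMulRightInvariant]
          (mQv : OrbitalMeasureFamily (Gqs L v)),
          mQv.IsCanonical (fun γ => IsRegularElt (γ.val : GL (Fin 3) (UnitaryGroup.LocalRing L v))) νQv →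
          ∀ (T : Subgroup (Gqs L v)), IsCompact ((T : Subgroup (Gqs L v)) : Set (Gqs L v)) →
          ∀ (γ₀ : Gqs L v), IsRegularElt (γ₀.val : GL (Fin 3) (UnitaryGroup.LocalRing L v)) → T = Subgroup.centralizer ({γ₀} : Set (Gqs L v)) →
          (∀ γ ∈ T, IsRegularElt (γ.val : GL (Fin 3) (UnitaryGroup.LocalRing L v)) → ∀ c : UnitaryGroup.LocalRing L v, ¬ ((γ.val.val : Matrix (Fin 3) (Fin 3) (UnitaryGroup.LocalRing L v)).charpoly).IsRoot c) →
          ∀ (S : Finset (ConjClasses (Gqs L v))) (mU : OrbitalMeasureFamily (Gqs L v)) (Γ : ConjClasses (Gqs L v) → ConjClasses (Gqs L v) → ℂ),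
            (∀ u ∈ S, (((Quotient.out u : Gqs L v).val : GL (Fin 3) (UnitaryGroup.LocalRing L v)).val - 1) ^ 3 = 0) →
            mU.IsAdmissibleOn (fun γ : Gqs L v => (ConjClasses.mk γ) ∈ S) →
            (∀ f : Gqs L v → ℂ, IsLocSmooth f →
              ∃ W ∈ 𝓝 (fun i : Fin 3 => ((1 : Matrix (Fin 3) (Fin 3) (UnitaryGroup.LocalRing L v)).charpoly).coeff i),
                ∀ c : ConjClasses (Gqs L v),
                  IsRegularElt ((Quotient.out c : Gqs L v).val : GL (Fin 3) (UnitaryGroup.LocalRing L v)) →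
                  (fun i : Fin 3 => ((Quotient.out c : Gqs L v).val : GL (Fin 3) (UnitaryGroup.LocalRing L v)).val.charpoly.coeff i) ∈ W →
                    classOrbitalIntegral mQv f c = ∑ u ∈ S, classOrbitalIntegral mU f u * Γ u c) →
            ∃ (γseq : ℕ → Gqs L v) (q : ℂ) (a : ConjClasses (Gqs L v) → ℕ) (g : ConjClasses (Gqs L v) → ℂ) (n₀ : ℕ),
              (∀ n, γseq n ∈ (T : Set (Gqs L v)) ∧ IsRegularElt ((γseq n).val : GL (Fin 3) (UnitaryGroup.LocalRing L v))) ∧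
              Tendsto γseq atTop (𝓝 (1 : Gqs L v)) ∧ 1 < ‖q‖ ∧
              (∀ u ∈ S, u ≠ ConjClasses.mk 1 → 1 ≤ a u) ∧
              ∀ u ∈ S, u ≠ ConjClasses.mk 1 → ∀ n, n₀ ≤ n → Γ u (ConjClasses.mk (γseq n)) = q ^ (n * a u) * g u) :
    ∀ (L : Type) [Field L] [NumberField L] [IsCMField L] (v : HeightOneSpectrum (𝓞 ↥(maximalRealSubfield L))),
      (∀ w : PlacesOver L v, IsCMField.complexConj L • w.1 = w.1) →
      ShalikaGermExpansionNonsplit L (qsForm L) v →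
      ∀ [MeasurableSpace (Gqs L v)] [BorelSpace (Gqs L v)] (νQv : Measure (Gqs L v)) [νQv.IsHaarMeasure] [νQv.IsMulRightInvariant],
      letI : ∀ γ : Gqs L v, MeasurableSpace (Gqs L v ⧸ Subgroup.centralizer ({γ} : Set (Gqs L v))) := fun _ => borel _
      haveI : ∀ γ : Gqs L v, BorelSpace (Gqs L v ⧸ Subgroup.centralizer ({γ} : Set (Gqs L v))) := fun _ => ⟨rfl⟩
      ∀ (mQv : OrbitalMeasureFamily (Gqs L v)),
        mQv.IsCanonical (fun γ => IsRegularElt (γ.val : GL (Fin 3) (UnitaryGroup.LocalRing L v))) νQv →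
        ∀ (T : Subgroup (Gqs L v)), IsCompact ((T : Subgroup (Gqs L v)) : Set (Gqs L v)) ∧
          (∃ γ₀ : Gqs L v, IsRegularElt (γ₀.val : GL (Fin 3) (UnitaryGroup.LocalRing L v)) ∧ T = Subgroup.centralizer ({γ₀} : Set (Gqs L v))) →
          (∀ γ ∈ T, IsRegularElt (γ.val : GL (Fin 3) (UnitaryGroup.LocalRing L v)) → ∀ c : UnitaryGroup.LocalRing L v, ¬ ((γ.val.val : Matrix (Fin 3) (Fin 3) (UnitaryGroup.LocalRing L v)).charpoly).IsRoot c) →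
          ShalikaGermResidueAtTorus L (qsForm L) v mQv T := by
  intro L _ _ _ v hns hexp _ _ νQv _ _ mQv hcan T hTγ hT3
  letI : ∀ γ : Gqs L v, MeasurableSpace (Gqs L v ⧸ Subgroup.centralizer ({γ} : Set (Gqs L v))) := fun _ => borel _
  haveI : ∀ γ : Gqs L v, BorelSpace (Gqs L v ⧸ Subgroup.centralizer ({γ} : Set (Gqs L v))) := fun _ => ⟨rfl⟩
  obtain ⟨hT, γ₀, hγ₀, hTγ₀⟩ := hTγ
  obtain ⟨S, mU, Γ, hunip, hadm, -, hgerm⟩ := hexp mQv hcan.isAdmissibleOn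
  obtain ⟨γseq, q, a, g, n₀, hγT, hγ1, hq, ha, hhom⟩ := hHOM L v hns νQv mQv hcan T hT γ₀ hγ₀ hTγ₀ hT3 S mU Γ hunip hadm hgerm
  obtain ⟨w⟩ := PlacesOver.nonempty L v
  by_cases hw : v.asIdeal.ramificationIdx' w.1.asIdeal = 1 ∨ Valued.v (2 : w.1.adicCompletion L) = 1
  · obtain ⟨fG, hfGs, -, -, -, hfGim, hfGre, hell, -⟩ := exists_epFunction_G_of_ramificationIdx'_or_valued_two L v hns w hw νQv hcan
    exact germResidueAtTorus_of_epFunction_of_homogeneityRay L v mQv hT hγ₀ hTγ₀ hfGs hfGim hfGre.ne hell S mU Γ hgerm γseq hγT hγ1 q hq a g n₀ ha hhom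
  · rw [not_or] at hw
    have h2le : Valued.v (2 : w.1.adicCompletion L) ≤ 1 := by
      have h : (2 : w.1.adicCompletion L) = 1 + 1 := by norm_num
      rw [h]
      exact (Valuation.map_add _ _ _).trans (by rw [Valuation.map_one, max_self])
    obtain ⟨fG, hfGs, -, -, -, hfGim, hfGre, hell, -⟩ := K2E3EPFunctionGWild.epFunctionGWild L v hns w hw.1 (lt_of_le_of_ne h2le hw.2) νQv mQv hcan
    exact germResidueAtTorus_of_epFunction_of_homogeneityRay L v mQv hT hγ₀ hTγ₀ hfGs hfGim hfGre.ne hell S mU Γ hgerm γseq hγT hγ1 q hq a g n₀ ha hhom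

end Summit.HodgeConjecture.HodgeConjecture.Cruxes.H413.K2E3GermResidueAtCubicTorusOfRay

end
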